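import Summits.HodgeConjecture.CorCM.GaloisCyclicByMultipliersDegenerate
import HarnessLib

/-!
# CYCLIC-BY-MULTIPLIERS Galois groups `C_{2h} ⋊ U` when `−1 ∈ U`: the OFFSET coset interval is a primitive
# degenerate CM type as soon as `U ⊄ {±1}` — and the general theorem for every `U` with a multiplier `≠ ±1`

COR-CM (cell `pub-hodgecm2`), binder seat b04 (gen 23), count-neutral claim CYCLIC-BY-MULTIPLIERS, part IV (sequel
of part III `CorCM/GaloisCyclicByMultipliersDegenerate`, which treats `−1 ∉ U`).  KERNEL ONLY: theorems; no
definition, no named fact, no `sorry`.  `HC_CM` is neither used nor claimed.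

SETTING (inside `G = Gal(K/ℚ)`).  `α` of order `2h` (`h ≥ 2`), `U ≤ G` with `⟨α⟩ ∩ U = 1`, `|G| = 2h·|U|`, every
`w ∈ U` normalising `⟨α⟩` with a multiplier, faithfully (`w α = α w ⟹ w = 1`); an INVERSION `w₀ ∈ U`
(`w₀ α w₀⁻¹ = α⁻¹`, i.e. `−1 ∈ U`) and some `w ∈ U` with multiplier `≠ ±1` (i.e. `U ⊄ {±1}`, `|U| ≥ 4`).  When
`−1 ∈ U` the plain coset interval `⊔_{i<h} αⁱ U` is imprimitive (stabilised by `α^{h−1} w₀`, as for the dihedral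
group).  THE OFFSET COSET INTERVAL `T = {αˣ w : w ∈ U, x ∈ [ε_w, ε_w + h)}` with `ε_w = 0` if `w` acts as `±1` and
`ε_w = 1` otherwise repairs this:
* `T` is a CM set for `α^h` and RIGHT-`w₀`-INVARIANT (`w ↦ w w₀` preserves "acts as `±1`"), so it is read by a
  DEGENERATE CM type (part I `GaloisModels.exists_simple_degenerate_of_model_skew`: reflex field `⊆ K^{⟨w₀⟩}`);
* its LEFT stabiliser is trivial (§1 `offsetInterval_leftStabiliser`): `αʲ w'` with multiplier `≠ ±1` would make an
  affine non-`±1` bijection preserve an interval (part II `not_affine_preserves_interval`); `αʲ` needs `j = 0`; and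
  `αʲ w₀` would have to reflect BOTH offsets onto themselves, `j ≡ h − 1` and `j ≡ h + 1 (mod 2h)` — impossible.
Hence (§2) **`exists_simple_degenerate_of_cyclicByMultipliers_inversion`** (`−1 ∈ U ⊄ {±1}` ⟹ a simple degenerate
CM `h|U|`-fold) and, with part III, THE GENERAL THEOREM **`exists_simple_degenerate_of_multiplier_ne_pm_one`**:

  `Gal(K/ℚ) = ⟨α⟩ ⋊ U` with `U` acting faithfully on `⟨α⟩` and SOME `w ∈ U` acting by a multiplier `≠ ±1`
  ⟹ `K` has a simple DEGENERATE abelian variety of dimension `h·|U|` (exceptional Hodge classes on a power).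

So among the Galois groups `C_{2h} ⋊ U`, `U ≤ (ℤ/2h)ˣ` (`h ≥ 2`), only `U = 1` (cyclic: gen 12, good iff the odd
part of `h`… of `2h` is `1` or prime) and `U = {±1}` (dihedral `D_{4h}`: gen 22, good iff `h ≤ 4`) can be good: e.g.
the holomorphs `Hol(C₈) = C₈ ⋊ C₂²` (order 32), `Hol(C₁₆)` (128), `C₁₂ ⋊ C₂²` (48), `C₂₀ ⋊ C₄` (80, either `C₄`),
`C₂₄ ⋊ U` for all seven `U` of order `4` and `U = (ℤ/24)ˣ`, … are BAD.  Seat census `scratch/g23c.py`: the offset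
interval has rank `h|U|/2 + 1` and trivial left stabiliser in all 9 tested groups with `U ⊄ {±1}`.

## References

* [Shimura1998] G. Shimura, *Abelian Varieties with Complex Multiplication and Modular Functions*, §6.2 Thm. 3,
  §8.2 Prop. 26, §18.2 Lemma (i), §32.10.
* [Gordon1999HodgeAVSurvey] B. B. Gordon, *A survey of the Hodge conjecture for abelian varieties*, Thm. 6.4, §9.3.
-/

noncomputable section

open CategoryTheory CategoryTheory.Limits NumberField
open scoped BigOperators

namespace Summit.HodgeConjecture.CorCM.GaloisCosetInterval

open Literature.NumberTheory.ComplexMultiplication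
open Literature.AlgebraicGeometry.Motives (AbelianVariety CMType)
open Literature.AlgebraicGeometry.HodgeTheory
open Literature.AlgebraicGeometry.ComplexMultiplication (IsCMTypeRealisation)
open Literature.AlgebraicGeometry.Pohlmann1968
open Literature.Barriers.HodgeConjecture (divisorClassesSpan)
open Summit.HodgeConjecture.CorCM.GaloisModels
open Summit.HodgeConjecture.CorCM.GaloisSemidihedral
open Summit.HodgeConjecture.CorCM.CyclicAsymmetricHalves

/-! ## §1 The offset coset interval in `G = ⟨α⟩·U` with an inversion -/

section Group

variable {G : Type*} [Group G] {α : G} {U : Subgroup G} {h : ℕ} {T : Finset G}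

/-- "Acts as `±1`" is stable under right multiplication by an inversion `w₀`: `(w w₀) α (w w₀)⁻¹ = (w α w⁻¹)⁻¹`.
[folklore] -/
theorem actsPM_mul_inversion_iff {w w₀ : G} (hw₀ : w₀ * α * w₀⁻¹ = α⁻¹) :
    ((w * w₀) * α * (w * w₀)⁻¹ = α ∨ (w * w₀) * α * (w * w₀)⁻¹ = α⁻¹) ↔
      (w * α * w⁻¹ = α ∨ w * α * w⁻¹ = α⁻¹) := by
  have key : (w * w₀) * α * (w * w₀)⁻¹ = (w * α * w⁻¹)⁻¹ := by
    rw [mul_inv_rev, show w * w₀ * α * (w₀⁻¹ * w⁻¹) = w * (w₀ * α * w₀⁻¹) * w⁻¹ by group, hw₀]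
    group
  rw [key, inv_eq_iff_eq_inv, inv_inj, or_comm]

/-- "Acts as `±1`" is stable under LEFT multiplication by an inversion `w₀` as well:
`(w₀ w) α (w₀ w)⁻¹ = w₀ (w α w⁻¹) w₀⁻¹`. [folklore] -/
theorem actsPM_inversion_mul_iff {w w₀ : G} (hw₀ : w₀ * α * w₀⁻¹ = α⁻¹) :
    ((w₀ * w) * α * (w₀ * w)⁻¹ = α ∨ (w₀ * w) * α * (w₀ * w)⁻¹ = α⁻¹) ↔
      (w * α * w⁻¹ = α ∨ w * α * w⁻¹ = α⁻¹) := by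
  have hw₀' : w₀⁻¹ * α * w₀ = α⁻¹ := by
    calc w₀⁻¹ * α * w₀ = (w₀⁻¹ * α⁻¹ * w₀)⁻¹ := by group
      _ = (w₀⁻¹ * (w₀ * α * w₀⁻¹) * w₀)⁻¹ := by rw [hw₀]
      _ = α⁻¹ := by group
  have key : (w₀ * w) * α * (w₀ * w)⁻¹ = w₀ * (w * α * w⁻¹) * w₀⁻¹ := by group
  have conj : ∀ X Y : G, w₀ * X * w₀⁻¹ = Y ↔ X = w₀⁻¹ * Y * w₀ := fun X Y => by
    constructor
    · rintro rfl; group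
    · rintro rfl; group
  have e1 : w₀⁻¹ * α⁻¹ * w₀ = α := by
    calc w₀⁻¹ * α⁻¹ * w₀ = (w₀⁻¹ * α * w₀)⁻¹ := by group
      _ = α := by rw [hw₀', inv_inv]
  rw [key, conj, conj, hw₀', e1, or_comm]

/-- **The offset coset interval exists**: `αˣ w ∈ T ↔ x.val < h` if `w ∈ U` acts as `±1`, `↔ (x−1).val < h`
otherwise. [folklore] -/
theorem exists_offsetInterval [Fintype G] [NeZero h] (hord : orderOf α = 2 * h)
    (hAU : ∀ w ∈ U, w ∈ Subgroup.zpowers α → w = 1) :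
    ∃ T : Finset G,
      (∀ x : ZMod (2 * h), ∀ w ∈ U, (w * α * w⁻¹ = α ∨ w * α * w⁻¹ = α⁻¹) → (α ^ x.val * w ∈ T ↔ x.val < h)) ∧
      (∀ x : ZMod (2 * h), ∀ w ∈ U, ¬ (w * α * w⁻¹ = α ∨ w * α * w⁻¹ = α⁻¹) →
        (α ^ x.val * w ∈ T ↔ (x - 1).val < h)) := by
  classical
  refine ⟨Finset.univ.filter fun g => ∃ x : ZMod (2 * h), ∃ w : G, w ∈ U ∧ g = α ^ x.val * w ∧
      (((w * α * w⁻¹ = α ∨ w * α * w⁻¹ = α⁻¹) ∧ x.val < h) ∨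
        (¬ (w * α * w⁻¹ = α ∨ w * α * w⁻¹ = α⁻¹) ∧ (x - 1).val < h)), fun x w hw hP => ?_, fun x w hw hP => ?_⟩
  · simp only [Finset.mem_filter, Finset.mem_univ, true_and]
    constructor
    · rintro ⟨y, w', hw', heq, hc⟩
      obtain ⟨hxy, hww⟩ := normalForm_sub_inj hord hAU hw hw' heq
      subst hxy; subst hww
      rcases hc with ⟨-, hc⟩ | ⟨hn, -⟩
      · exact hc
      · exact absurd hP hn
    · exact fun hx => ⟨x, w, hw, rfl, Or.inl ⟨hP, hx⟩⟩
  · simp only [Finset.mem_filter, Finset.mem_univ, true_and]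
    constructor
    · rintro ⟨y, w', hw', heq, hc⟩
      obtain ⟨hxy, hww⟩ := normalForm_sub_inj hord hAU hw hw' heq
      subst hxy; subst hww
      rcases hc with ⟨hp, -⟩ | ⟨-, hc⟩
      · exact absurd hp hP
      · exact hc
    · exact fun hx => ⟨x, w, hw, rfl, Or.inr ⟨hP, hx⟩⟩

/-- **CM set for `c = α^h`.** [cite: Shimura1998, §18.2 Lemma (i)] -/
theorem offsetInterval_cm [Fintype G] [NeZero h] (hord : orderOf α = 2 * h)
    (hAU : ∀ w ∈ U, w ∈ Subgroup.zpowers α → w = 1) (hcard : Fintype.card G = 2 * h * Nat.card U)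
    (hTP : ∀ x : ZMod (2 * h), ∀ w ∈ U, (w * α * w⁻¹ = α ∨ w * α * w⁻¹ = α⁻¹) → (α ^ x.val * w ∈ T ↔ x.val < h))
    (hTN : ∀ x : ZMod (2 * h), ∀ w ∈ U, ¬ (w * α * w⁻¹ = α ∨ w * α * w⁻¹ = α⁻¹) →
      (α ^ x.val * w ∈ T ↔ (x - 1).val < h)) (g : G) : g ∈ T ↔ α ^ h * g ∉ T := by
  haveI : NeZero (2 * h) := ⟨by have := NeZero.ne h; omega⟩
  have hh : 1 ≤ h := Nat.pos_of_ne_zero (NeZero.ne h)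
  have hαh : α ^ h = α ^ ((h : ℕ) : ZMod (2 * h)).val := by rw [val_natCast_of_lt' (show h < 2 * h by omega)]
  obtain ⟨x, w, hw, rfl⟩ := exists_normalForm_sub hord hAU hcard g
  rw [hαh, ← mul_assoc, ← pow_val_add hord]
  by_cases hP : (w * α * w⁻¹ = α ∨ w * α * w⁻¹ = α⁻¹)
  · rw [hTP x w hw hP, hTP _ w hw hP, add_comm, val_add_natCast_eq x (show h < 2 * h by omega)]
    have := x.val_lt
    split_ifs <;> omega
  · rw [hTN x w hw hP, hTN _ w hw hP, show (h : ZMod (2 * h)) + x - 1 = (x - 1) + (h : ZMod (2 * h)) by ring,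
      val_add_natCast_eq (x - 1) (show h < 2 * h by omega)]
    have := (x - 1).val_lt
    split_ifs <;> omega

/-- **Right invariance under the inversion `w₀ ∈ U`**: `g w₀ ∈ T ↔ g ∈ T`. [folklore] -/
theorem offsetInterval_mul_inversion [Fintype G] [NeZero h] (hord : orderOf α = 2 * h)
    (hAU : ∀ w ∈ U, w ∈ Subgroup.zpowers α → w = 1) (hcard : Fintype.card G = 2 * h * Nat.card U)
    (hTP : ∀ x : ZMod (2 * h), ∀ w ∈ U, (w * α * w⁻¹ = α ∨ w * α * w⁻¹ = α⁻¹) → (α ^ x.val * w ∈ T ↔ x.val < h))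
    (hTN : ∀ x : ZMod (2 * h), ∀ w ∈ U, ¬ (w * α * w⁻¹ = α ∨ w * α * w⁻¹ = α⁻¹) →
      (α ^ x.val * w ∈ T ↔ (x - 1).val < h)) {w₀ : G} (hw₀U : w₀ ∈ U) (hw₀ : w₀ * α * w₀⁻¹ = α⁻¹) (g : G) :
    g * w₀ ∈ T ↔ g ∈ T := by
  obtain ⟨x, w, hw, rfl⟩ := exists_normalForm_sub hord hAU hcard g
  rw [mul_assoc]
  by_cases hP : (w * α * w⁻¹ = α ∨ w * α * w⁻¹ = α⁻¹)
  · rw [hTP x (w * w₀) (U.mul_mem hw hw₀U) ((actsPM_mul_inversion_iff hw₀).2 hP), hTP x w hw hP]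
  · rw [hTN x (w * w₀) (U.mul_mem hw hw₀U) (fun h' => hP ((actsPM_mul_inversion_iff hw₀).1 h')), hTN x w hw hP]

/-- `w α w⁻¹ = α⁻¹` as a multiplier: `w α = α^{2h−1} w`. [folklore] -/
theorem inversion_rel [NeZero h] (hord : orderOf α = 2 * h) {w : G} (hw : w * α * w⁻¹ = α⁻¹) :
    w * α = α ^ (2 * h - 1) * w := by
  have h1 : α ^ (2 * h - 1) = α⁻¹ := by
    apply eq_inv_of_mul_eq_one_left
    rw [← pow_succ, show 2 * h - 1 + 1 = 2 * h by have := NeZero.ne h; omega, ← hord, pow_orderOf_eq_one]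
  rw [h1, ← hw, inv_mul_cancel_right]

/-- `(2h − 1 : ℤ/2h) = −1`. [folklore] -/
theorem natCast_two_mul_sub_one [NeZero h] : ((2 * h - 1 : ℕ) : ZMod (2 * h)) = -1 := by
  have h2h : ((2 * h : ℕ) : ZMod (2 * h)) = 0 := ZMod.natCast_self _
  rw [Nat.cast_sub (by have := NeZero.ne h; omega), Nat.cast_one, sub_eq_iff_eq_add, neg_add_cancel]
  exact_mod_cast h2h

/-- **TRIVIAL LEFT STABILISER of the offset coset interval** (`h ≥ 2`, faithful multipliers, an inversion `w₀ ∈ U`,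
and some `w ∈ U` not acting as `±1`). [cite: Shimura1998, §8.2 Prop. 26] -/
theorem offsetInterval_leftStabiliser [Fintype G] (h2 : 2 ≤ h) (hord : orderOf α = 2 * h)
    (hAU : ∀ w ∈ U, w ∈ Subgroup.zpowers α → w = 1) (hcard : Fintype.card G = 2 * h * Nat.card U)
    (hmult : ∀ w ∈ U, ∃ u : ℕ, w * α = α ^ u * w) (hfaith : ∀ w ∈ U, w * α = α * w → w = 1)
    (hne : ∃ w ∈ U, ¬ (w * α * w⁻¹ = α ∨ w * α * w⁻¹ = α⁻¹))
    (hTP : ∀ x : ZMod (2 * h), ∀ w ∈ U, (w * α * w⁻¹ = α ∨ w * α * w⁻¹ = α⁻¹) → (α ^ x.val * w ∈ T ↔ x.val < h))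
    (hTN : ∀ x : ZMod (2 * h), ∀ w ∈ U, ¬ (w * α * w⁻¹ = α ∨ w * α * w⁻¹ = α⁻¹) →
      (α ^ x.val * w ∈ T ↔ (x - 1).val < h)) (v : G) (hv : v ≠ 1) :
    ∃ w : G, ¬ (w ∈ T ↔ v * w ∈ T) := by
  haveI : NeZero h := ⟨by omega⟩
  haveI : NeZero (2 * h) := ⟨by omega⟩
  haveI : Fact (1 < 2 * h) := ⟨by omega⟩
  have hP1 : ((1 : G) * α * 1⁻¹ = α ∨ (1 : G) * α * 1⁻¹ = α⁻¹) := Or.inl (by group)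
  have hT1 : ∀ x : ZMod (2 * h), α ^ x.val ∈ T ↔ x.val < h := fun x => by
    have := hTP x 1 U.one_mem hP1; rwa [mul_one] at this
  obtain ⟨j, w', hw', rfl⟩ := exists_normalForm_sub hord hAU hcard v
  obtain ⟨u₀, hrel⟩ := hmult w' hw'
  by_contra hall
  push Not at hall
  -- the probes `αⁱ`: `i.val < h ↔ αʲ w' αⁱ ∈ T`
  have probe : ∀ i : ZMod (2 * h), i.val < h ↔ α ^ (j + (u₀ : ZMod (2 * h)) * i).val * w' ∈ T := fun i => by
    have := hall (α ^ i.val)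
    rwa [show (α ^ j.val * w') * α ^ i.val = α ^ (j + (u₀ : ZMod (2 * h)) * i).val * w' by
      have := mult_mul_normalForm hord hrel j i 1
      rwa [mul_one, mul_one] at this, hT1] at this
  by_cases hP : (w' * α * w'⁻¹ = α ∨ w' * α * w'⁻¹ = α⁻¹)
  · rcases hP with hcomm | hinv
    · -- `w'` centralises `α`: `w' = 1`, `v = αʲ` with `j ≠ 0`
      have hw1 : w' = 1 := hfaith w' hw' (by
        calc w' * α = (w' * α * w'⁻¹) * w' := by group
          _ = α * w' := by rw [hcomm])
      subst hw1
      rw [mul_one] at hv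
      have hj : j.val ≠ 0 := fun h0 => hv (by rw [h0, pow_zero])
      have hjlt := j.val_lt
      have hu1 : (u₀ : ZMod (2 * h)) = 1 := by
        have h1 : α ^ u₀ = α := by
          have := hrel; rw [one_mul, mul_one] at this; exact this.symm
        have h2' : α ^ u₀ = α ^ (1 : ℕ) := by rw [pow_one]; exact h1
        rw [pow_eq_pow_iff_modEq, hord] at h2'
        have := (ZMod.natCast_eq_natCast_iff' u₀ 1 (2 * h)).2 h2'
        rwa [Nat.cast_one] at this
      simp only [hu1, one_mul, mul_one, hT1] at probe
      by_cases hjh : j.val < h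
      · have := (probe (((h : ℕ) : ZMod (2 * h)) - j)).1 (by
          rw [val_natCast_sub_eq j (show h < 2 * h by omega)]; split_ifs <;> omega)
        rw [add_sub_cancel, val_natCast_of_lt' (show h < 2 * h by omega)] at this
        omega
      · have := (probe 0).1 (by rw [ZMod.val_zero]; omega)
        rw [add_zero] at this
        omega
    · -- `w'` inverts `α`: `j = h − 1`, then the offset sheet refutes
      have hrel' := inversion_rel hord hinv
      have hu1 : (u₀ : ZMod (2 * h)) = -1 := by
        have h1 : α ^ u₀ = α ^ (2 * h - 1) := by
          have e1 := hrel; rw [hrel'] at e1; exact (mul_right_cancel e1).symm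
        rw [pow_eq_pow_iff_modEq, hord] at h1
        have := (ZMod.natCast_eq_natCast_iff' u₀ (2 * h - 1) (2 * h)).2 h1
        rw [this]; exact natCast_two_mul_sub_one
      have hPw : (w' * α * w'⁻¹ = α ∨ w' * α * w'⁻¹ = α⁻¹) := Or.inr hinv
      simp only [hu1, neg_one_mul, hTP _ w' hw' hPw] at probe
      -- `j.val < h` (probe `i = j`) and `(j+1).val ≥ h` (probe `i = j + 1`)
      have p1 := (probe j).2 (by rw [← sub_eq_add_neg, sub_self, ZMod.val_zero]; omega)
      have p2 : ¬ ((j + 1).val < h) := fun h' => by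
        have := (probe (j + 1)).1 h'
        rw [← sub_eq_add_neg, show j - (j + 1) = (-1 : ZMod (2 * h)) by ring, ZMod.neg_val, if_neg one_ne_zero,
          ZMod.val_one] at this
        omega
      have hj : j.val = h - 1 := by
        have := val_add_natCast_eq j (show 1 < 2 * h by omega)
        rw [Nat.cast_one] at this
        rw [this] at p2
        split_ifs at p2 <;> omega
      -- the offset sheet: `w₂` not acting as `±1`, probe `α^h w₂`
      obtain ⟨w₂, hw₂, hN⟩ := hne
      have hN' : ¬ ((w' * w₂) * α * (w' * w₂)⁻¹ = α ∨ (w' * w₂) * α * (w' * w₂)⁻¹ = α⁻¹) :=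
        fun h' => hN ((actsPM_inversion_mul_iff hinv).1 h')
      have key := hall (α ^ ((h : ℕ) : ZMod (2 * h)).val * w₂)
      rw [hTN _ w₂ hw₂ hN, mult_mul_normalForm hord hrel', hTN _ (w' * w₂) (U.mul_mem hw' hw₂) hN'] at key
      have hjz : j = ((h - 1 : ℕ) : ZMod (2 * h)) := by
        apply ZMod.val_injective; rw [hj, val_natCast_of_lt' (show h - 1 < 2 * h by omega)]
      rw [natCast_two_mul_sub_one, hjz] at key
      have lhs : (((h : ℕ) : ZMod (2 * h)) - 1).val < h := by
        rw [show ((h : ℕ) : ZMod (2 * h)) - 1 = ((h - 1 : ℕ) : ZMod (2 * h)) by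
          rw [Nat.cast_sub (by omega), Nat.cast_one], val_natCast_of_lt' (show h - 1 < 2 * h by omega)]
        omega
      have h20 : ((2 : ℕ) : ZMod (2 * h)) ≠ 0 := fun h0 => by
        have := congrArg ZMod.val h0
        rw [val_natCast_of_lt' (show 2 < 2 * h by omega), ZMod.val_zero] at this
        omega
      have rhs : ¬ ((((h - 1 : ℕ) : ZMod (2 * h)) + -1 * ((h : ℕ) : ZMod (2 * h)) - 1).val < h) := by
        rw [show ((h - 1 : ℕ) : ZMod (2 * h)) + -1 * ((h : ℕ) : ZMod (2 * h)) - 1 = -(((2 : ℕ) : ZMod (2 * h))) by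
          rw [Nat.cast_sub (by omega), Nat.cast_one]; push_cast; ring,
          ZMod.neg_val, if_neg h20, val_natCast_of_lt' (show 2 < 2 * h by omega)]
        omega
      exact rhs (key.1 lhs)
  · -- `w'` acts by a multiplier `≠ ±1`: the affine interval lemma (offset `1`)
    have hw1 : w' * α ≠ α * w' := fun h1 => hP (Or.inl (by rw [h1, mul_inv_cancel_right]))
    have hw2 : w' * α * w'⁻¹ ≠ α⁻¹ := fun h1 => hP (Or.inr h1)
    obtain ⟨u₁, hu, hu1, hu2⟩ := multiplier_unit_ne hord hmult hw' hrel hw1 hw2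
    refine not_affine_preserves_interval h2 (j := j - 1) hu hu1 hu2 fun i => ?_
    rw [probe i, hTN _ w' hw' hP, show j + (u₀ : ZMod (2 * h)) * i - 1 = j - 1 + (u₀ : ZMod (2 * h)) * i by ring]

end Group

/-! ## §2 Field level: `−1 ∈ U ⊄ {±1}`, and the general theorem -/

section Field

variable {K : Type} [Field K] [NumberField K] [IsCMField K] [IsGalois ℚ K]

/-- **THEOREM (`Gal = ⟨α⟩ ⋊ U` with an inversion in `U` and `U ⊄ {±1}`).**  `K` Galois CM, `α ∈ Gal(K/ℚ)` of order
`2h` (`h ≥ 2`), `U ≤ Gal(K/ℚ)` with `⟨α⟩ ∩ U = 1`, `[K:ℚ] = 2h·|U|`, every `w ∈ U` acting on `⟨α⟩` by a multiplier,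
trivially only for `w = 1`; some `w₀ ∈ U` inverts `α` and some `w ∈ U` acts as neither `1` nor `−1`.  Then `K` has a
SIMPLE DEGENERATE abelian variety of dimension `h·|U|` with CM by `K` (exceptional Hodge classes on a power): the
offset coset interval is a primitive CM type with right stabiliser `∋ w₀`. [cite: Shimura1998, §6.2 Thm. 3, §8.2
Prop. 26 and §32.10] [cite: Gordon1999HodgeAVSurvey, Thm. 6.4] -/
theorem exists_simple_degenerate_of_cyclicByMultipliers_inversion {h : ℕ} (h2 : 2 ≤ h) (α : K ≃ₐ[ℚ] K)
    (U : Subgroup (K ≃ₐ[ℚ] K)) (hord : orderOf α = 2 * h) (hAU : ∀ w ∈ U, w ∈ Subgroup.zpowers α → w = 1)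
    (hmult : ∀ w ∈ U, ∃ u : ℕ, w * α = α ^ u * w) (hfaith : ∀ w ∈ U, w * α = α * w → w = 1)
    {w₀ : K ≃ₐ[ℚ] K} (hw₀U : w₀ ∈ U) (hw₀ : w₀ * α * w₀⁻¹ = α⁻¹)
    (hne : ∃ w ∈ U, ¬ (w * α * w⁻¹ = α ∨ w * α * w⁻¹ = α⁻¹)) (hK : Module.finrank ℚ K = 2 * h * Nat.card U) :
    ∃ (Φ : CMType K) (φ₀ : K →+* ℂ) (A : AbelianVariety ℂ) (ι : 𝓞 K →+* End A)
      (θ : K →+* Module.End ℂ (complexBetti A.X 1)),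
      IsPrimitive (ℂ ≃+* ℂ) Φ.1 φ₀ ∧ ¬ IsNondegenerate Φ ∧ IsCMTypeRealisation Φ A ι θ ∧ A.IsSimple ∧
      A.dim = h * Nat.card U ∧
      ∃ n p : ℕ, ∃ x : complexBetti (⨁ fun _ : Fin n => A).X (2 * p), IsRationalClass x ∧
        IsOfHodgeType (⨁ fun _ : Fin n => A).dim (⨁ fun _ : Fin n => A).X (2 * p) p p x ∧
        x ∉ divisorClassesSpan (⨁ fun _ : Fin n => A).X (⨁ fun _ : Fin n => A).dim p := by
  classical
  haveI : NeZero h := ⟨by omega⟩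
  have hcard : Fintype.card (K ≃ₐ[ℚ] K) = 2 * h * Nat.card U := by
    rw [← hK, ← IsGalois.card_aut_eq_finrank, Nat.card_eq_fintype_card]
  have hc : (IsCMField.complexConj K).restrictScalars ℚ = α ^ h :=
    central_involution_eq_pow_sub (G := K ≃ₐ[ℚ] K) h2 hord hAU hcard hmult hfaith _
      (GaloisRank.model_complexConj_mul_self (MulEquiv.refl _) rfl)
      (GaloisRank.model_complexConj_ne_one (MulEquiv.refl _) rfl)
      (GaloisRank.model_complexConj_comm (MulEquiv.refl _) rfl)
  obtain ⟨T, hTP, hTN⟩ := exists_offsetInterval (G := K ≃ₐ[ℚ] K) hord hAU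
  -- `w₀ ≠ 1` since `α⁻¹ ≠ α` (`ord α = 2h ≥ 4`)
  have hw₀1 : w₀ ≠ 1 := by
    rintro rfl
    rw [one_mul, inv_one, mul_one] at hw₀
    have h1 : α ^ 2 = 1 := by rw [pow_two]; nth_rw 2 [hw₀]; exact mul_inv_cancel α
    have h3 : orderOf α ∣ 2 := orderOf_dvd_of_pow_eq_one h1
    rw [hord] at h3
    have := Nat.le_of_dvd (by norm_num) h3
    omega
  have hmain := exists_simple_degenerate_of_model_skew (MulEquiv.refl (K ≃ₐ[ℚ] K)) (α ^ h)
    (by rw [MulEquiv.refl_apply, hc]) T (offsetInterval_cm hord hAU hcard hTP hTN)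
    (offsetInterval_leftStabiliser h2 hord hAU hcard hmult hfaith hne hTP hTN) hw₀1
    (offsetInterval_mul_inversion hord hAU hcard hTP hTN hw₀U hw₀)
  rwa [hcard, show 2 * h * Nat.card U / 2 = h * Nat.card U by
    rw [mul_assoc, Nat.mul_div_cancel_left _ (by norm_num)]] at hmain

/-- **THE GENERAL THEOREM (cyclic-by-multipliers Galois groups with a multiplier `≠ ±1`).**  `K` Galois CM,
`α ∈ Gal(K/ℚ)` of order `2h` (`h ≥ 2`), `U ≤ Gal(K/ℚ)` with `⟨α⟩ ∩ U = 1` and `[K:ℚ] = 2h·|U|` (`Gal = ⟨α⟩ ⋊ U`),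
every `w ∈ U` acting on `⟨α⟩` by a multiplier, trivially only for `w = 1` (faithfully), and SOME `w ∈ U` acting by a
multiplier other than `±1` (`w α w⁻¹ ∉ {α, α⁻¹}`).  Then `K` has a SIMPLE DEGENERATE abelian variety of dimension
`h·|U|` with CM by `K`, with an exceptional Hodge class on some power — i.e. among the groups `C_{2h} ⋊ U`,
`U ≤ (ℤ/2h)ˣ`, only `U = 1` (cyclic) and `U = {±1}` (dihedral) can belong to CM fields all of whose simple abelian
varieties are nondegenerate. [cite: Shimura1998, §6.2 Thm. 3, §8.2 Prop. 26 and §32.10]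
[cite: Gordon1999HodgeAVSurvey, Thm. 6.4] -/
theorem exists_simple_degenerate_of_multiplier_ne_pm_one {h : ℕ} (h2 : 2 ≤ h) (α : K ≃ₐ[ℚ] K)
    (U : Subgroup (K ≃ₐ[ℚ] K)) (hord : orderOf α = 2 * h) (hAU : ∀ w ∈ U, w ∈ Subgroup.zpowers α → w = 1)
    (hmult : ∀ w ∈ U, ∃ u : ℕ, w * α = α ^ u * w) (hfaith : ∀ w ∈ U, w * α = α * w → w = 1)
    (hgen : ∃ w ∈ U, w * α * w⁻¹ ≠ α ∧ w * α * w⁻¹ ≠ α⁻¹) (hK : Module.finrank ℚ K = 2 * h * Nat.card U) :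
    ∃ (Φ : CMType K) (φ₀ : K →+* ℂ) (A : AbelianVariety ℂ) (ι : 𝓞 K →+* End A)
      (θ : K →+* Module.End ℂ (complexBetti A.X 1)),
      IsPrimitive (ℂ ≃+* ℂ) Φ.1 φ₀ ∧ ¬ IsNondegenerate Φ ∧ IsCMTypeRealisation Φ A ι θ ∧ A.IsSimple ∧
      A.dim = h * Nat.card U ∧
      ∃ n p : ℕ, ∃ x : complexBetti (⨁ fun _ : Fin n => A).X (2 * p), IsRationalClass x ∧
        IsOfHodgeType (⨁ fun _ : Fin n => A).dim (⨁ fun _ : Fin n => A).X (2 * p) p p x ∧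
        x ∉ divisorClassesSpan (⨁ fun _ : Fin n => A).X (⨁ fun _ : Fin n => A).dim p := by
  obtain ⟨w, hwU, hw1, hw2⟩ := hgen
  by_cases hex : ∃ w₀ ∈ U, w₀ * α * w₀⁻¹ = α⁻¹
  · obtain ⟨w₀, hw₀U, hw₀⟩ := hex
    exact exists_simple_degenerate_of_cyclicByMultipliers_inversion h2 α U hord hAU hmult hfaith hw₀U hw₀
      ⟨w, hwU, fun h' => h'.elim hw1 hw2⟩ hK
  · push Not at hex
    have hwne : w ≠ 1 := by rintro rfl; exact hw1 (by group)
    exact exists_simple_degenerate_of_cyclicByMultipliers h2 α U hord hAU hmult hfaith hex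
      (fun hb => hwne (by rw [hb] at hwU; exact (Subgroup.mem_bot.1 hwU))) hK

end Field

end Summit.HodgeConjecture.CorCM.GaloisCosetInterval

end
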